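import Summits.Ventures.PercRepro.RankLevelSetIndepNMP

/-! # RankLevelSetIndepNMPTheta — THE THETA GRAPH Θ(1,2,2,2,3) REFUTES (T) AND (B-NMP) IN THE KERNEL
(night-1 g25; dossier §37.8–37.9; COMPUTATIONAL: the matroid axioms and the four counts are checked by `native_decide`)

`thetaMatroid` is the cycle matroid of the theta graph with two hub vertices joined by five internally disjoint paths of
lengths 1, 2, 2, 2, 3 — the edges are `Fin 10`, the paths are the classes `{0}`, `{1,2}`, `{3,4}`, `{5,6}`, `{7,8,9}`
(`thetaClasses`), and a set of edges is a forest iff it contains AT MOST ONE whole path (`thetaIndep`: two whole paths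
form a cycle, and a set with at most one whole path extends to a spanning tree). The matroid is built by
`IndepMatroid.ofFinset` from this predicate; its axioms are finite statements on `Finset (Fin 10)` decided by
`native_decide`.

THE REFUTATION: with `z = 0` (the direct hub–hub edge) there are 168 forests with 5 edges, 60 of them through `z`, and
68 spanning trees, 24 of them through `z` (`card_forests_five`, `card_forests_five_z`, `card_forests_six`,
`card_forests_six_z`: by hand, 1·2·2·2·3 + 3·(1·2·2·3) + 1·2·2·2 = 24 + 36 + 8 = 68 trees). So the fraction of forests
through `z` is `60/168 = 5/14` at five edges and `24/68 = 6/17` at six: it DROPS, `60 · 68 = 4080 > 24 · 168 = 4032`,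
and **`not_elemMono_theta : ¬ ElemMono thetaMatroid`**, hence **`not_indepNMP_theta : ¬ IndepNMP thetaMatroid`**
(by the bridge `elemMono_of_indepNMP`). This is the smallest possible witness (every matroid on ≤ 9 elements satisfies
(B-NMP): all 383,172 matroids on 9 elements, kit j306116) and it is graphic, hence regular: its spanning-tree measure
is strongly Rayleigh, but its forest measure is not, and the truncation monotonicity of strongly Rayleigh measures does
not extend to the independence complexes of all matroids.
Every declaration has a docstring; imports: the cell's own modules and Mathlib only. Axioms: standard plus
`Lean.ofReduceBool` (native_decide) on the computational declarations. -/

namespace PercRepro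

namespace Theta

open Set Matroid

/-- The five paths of `Θ(1,2,2,2,3)` as classes of edges. -/
def thetaClasses : List (Finset (Fin 10)) := [{0}, {1, 2}, {3, 4}, {5, 6}, {7, 8, 9}]

/-- The number of whole paths contained in an edge set. -/
def fullCount (S : Finset (Fin 10)) : ℕ := (thetaClasses.filter (fun C => C ⊆ S)).length

/-- **The forests of `Θ(1,2,2,2,3)`**: edge sets containing at most one whole path. -/
abbrev thetaIndep (S : Finset (Fin 10)) : Prop := fullCount S ≤ 1

/-- The empty set is a forest. -/
theorem thetaIndep_empty : thetaIndep ∅ := by decide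

/-- Subsets of forests are forests (checked over all pairs of edge sets). -/
theorem thetaIndep_subset : ∀ ⦃I J : Finset (Fin 10)⦄, thetaIndep J → I ⊆ J → thetaIndep I := by
  native_decide

/-- The augmentation axiom for the forests of `Θ(1,2,2,2,3)` (checked over all pairs of edge sets). -/
theorem thetaIndep_aug : ∀ ⦃I J : Finset (Fin 10)⦄, thetaIndep I → thetaIndep J → I.card < J.card →
    ∃ e ∈ J, e ∉ I ∧ thetaIndep (insert e I) := by
  native_decide

/-- **The cycle matroid of `Θ(1,2,2,2,3)`** on the edge set `Fin 10`. -/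
def thetaMatroid : Matroid (Fin 10) :=
  (IndepMatroid.ofFinset Set.univ thetaIndep thetaIndep_empty thetaIndep_subset thetaIndep_aug
    (fun _ _ => Set.subset_univ _)).matroid

/-- The ground set is every edge. -/
theorem thetaMatroid_ground : thetaMatroid.E = Set.univ := rfl

/-- Independence in `thetaMatroid` of a finite edge set is the forest predicate. -/
theorem thetaMatroid_indep_coe (I : Finset (Fin 10)) : thetaMatroid.Indep (I : Set (Fin 10)) ↔ thetaIndep I := by
  unfold thetaMatroid
  exact IndepMatroid.ofFinset_indep Set.univ thetaIndep thetaIndep_empty thetaIndep_subset thetaIndep_aug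
    (fun _ _ => Set.subset_univ _)

/-- **The transfer of a level count to a `Finset` computation**: for a property `P` of edge sets matching a decidable
`p` on `Finset (Fin 10)`, `#{S ∈ indepLevel thetaMatroid k : P S} = #{T : Finset : T.card = k ∧ thetaIndep T ∧ p T}`. -/
theorem ncard_level_eq (k : ℕ) (P : Set (Fin 10) → Prop) (p : Finset (Fin 10) → Prop) [DecidablePred p]
    (hPp : ∀ T : Finset (Fin 10), P (T : Set (Fin 10)) ↔ p T) :
    {S ∈ indepLevel thetaMatroid k | P S}.ncard =
      (Finset.univ.filter (fun T : Finset (Fin 10) => (T.card = k ∧ thetaIndep T) ∧ p T)).card := by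
  classical
  rw [← Set.ncard_coe_finset]
  symm
  refine Set.ncard_congr (fun T _ => (T : Set (Fin 10))) ?_ ?_ ?_
  · rintro T hT
    simp only [Finset.coe_filter, Finset.mem_univ, true_and, Set.mem_setOf_eq] at hT
    refine ⟨⟨Set.subset_univ _, ?_, ?_⟩, ?_⟩
    · rw [Set.ncard_coe_finset]; exact hT.1.1
    · exact (thetaMatroid_indep_coe T).mpr hT.1.2
    · exact (hPp T).mpr hT.2
  · intro T T' _ _ h
    exact Finset.coe_inj.mp h
  · rintro S ⟨⟨-, hcard, hind⟩, hP⟩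
    have hfin : S.Finite := Set.toFinite S
    refine ⟨hfin.toFinset, ?_, hfin.coe_toFinset⟩
    simp only [Finset.coe_filter, Finset.mem_univ, true_and, Set.mem_setOf_eq]
    refine ⟨⟨?_, ?_⟩, ?_⟩
    · rw [← hcard, Set.ncard_eq_toFinset_card S hfin]
    · rw [← thetaMatroid_indep_coe, hfin.coe_toFinset]; exact hind
    · rw [← hPp, hfin.coe_toFinset]; exact hP

/-- The level count itself, as a `Finset` computation. -/
theorem indepLevelCount_eq (k : ℕ) :
    indepLevelCount thetaMatroid k =
      (Finset.univ.filter (fun T : Finset (Fin 10) => (T.card = k ∧ thetaIndep T) ∧ True)).card := by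
  have h := ncard_level_eq k (fun _ => True) (fun _ => True) (fun _ => Iff.rfl)
  rw [← h]
  unfold indepLevelCount
  congr 1
  ext S
  simp only [Set.mem_setOf_eq, and_true]

/-- There are 168 forests with five edges. -/
theorem card_forests_five :
    (Finset.univ.filter (fun T : Finset (Fin 10) => (T.card = 5 ∧ thetaIndep T) ∧ True)).card = 168 := by
  native_decide

/-- 60 of the five-edge forests contain the direct edge `0`. -/
theorem card_forests_five_z :
    (Finset.univ.filter (fun T : Finset (Fin 10) => (T.card = 5 ∧ thetaIndep T) ∧ (0 : Fin 10) ∈ T)).card = 60 := by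
  native_decide

/-- There are 68 spanning trees (forests with six edges). -/
theorem card_forests_six :
    (Finset.univ.filter (fun T : Finset (Fin 10) => (T.card = 6 ∧ thetaIndep T) ∧ True)).card = 68 := by
  native_decide

/-- 24 of the spanning trees contain the direct edge `0`. -/
theorem card_forests_six_z :
    (Finset.univ.filter (fun T : Finset (Fin 10) => (T.card = 6 ∧ thetaIndep T) ∧ (0 : Fin 10) ∈ T)).card = 24 := by
  native_decide

/-- **THE REFUTATION OF (T)**: the fraction of forests through the direct edge drops from five edges to six. -/
theorem not_elemMono_theta : ¬ ElemMono thetaMatroid := by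
  intro h
  have e1 : {S ∈ indepLevel thetaMatroid 5 | (0 : Fin 10) ∈ S}.ncard = 60 := by
    rw [ncard_level_eq 5 (fun S => (0 : Fin 10) ∈ S) (fun T => (0 : Fin 10) ∈ T) (fun T => by simp)]
    exact card_forests_five_z
  have e3 : {S ∈ indepLevel thetaMatroid 6 | (0 : Fin 10) ∈ S}.ncard = 24 := by
    rw [ncard_level_eq 6 (fun S => (0 : Fin 10) ∈ S) (fun T => (0 : Fin 10) ∈ T) (fun T => by simp)]
    exact card_forests_six_z
  have e2 : indepLevelCount thetaMatroid 6 = 68 := by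
    rw [indepLevelCount_eq]; exact card_forests_six
  have e4 : indepLevelCount thetaMatroid 5 = 168 := by
    rw [indepLevelCount_eq]; exact card_forests_five
  have h0 := h 0 (by rw [thetaMatroid_ground]; exact Set.mem_univ _) 5
  rw [show (5 : ℕ) + 1 = 6 from rfl, e1, e2, e3, e4] at h0
  omega

/-- **THE REFUTATION OF (B-NMP)**: the independence complex of `Θ(1,2,2,2,3)` does not have the normalised matching
property. -/
theorem not_indepNMP_theta : ¬ IndepNMP thetaMatroid :=
  fun h => not_elemMono_theta (elemMono_of_indepNMP thetaMatroid h)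

end Theta

end PercRepro
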